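import Mathlib.Analysis.Calculus.ContDiff.RCLike
import Mathlib.Analysis.InnerProductSpace.PiL2
import Literature.Analysis.FunctionSpaces.TorusCalculus

/-!
# Amplitude transfer — pointwise calculus of a `C¹` path of profiles on the torus

For a path of profiles `f : ℝ → 𝕋³ → F` whose space–time lift `Torus.stLift f : ℝ × ℝ³ → F`,
`(s, y) ↦ f s (proj y)`, is `C¹` on `[0,1] × ℝ³` (the frame of `FieldVarianceBound` in route
`VitaliAmplitudeTransfer`; item `AmplitudeTransfer`, step (4)), the pointwise facts used by the
`δ`-derivative of local Gibbs means:

* every slice `f s`, `s ∈ [0,1]`, is continuous, and `s ↦ f s x` is continuous on `[0,1]`;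
* at interior `s ∈ (0,1)`, `s ↦ f s x` is differentiable, its derivative is continuous in `x`,
  and bounded uniformly in `(s, x) ∈ (0,1) × 𝕋³` (compactness of `[0,1] ×` a fundamental cube).
-/

noncomputable section

open Set Filter Topology Metric
open Literature.Analysis.FunctionSpaces

namespace Summit.AtomisticToContinuum.HydrodynamicLimit.Theorems.AmplitudeTransfer

variable {F : Type*} [NormedAddCommGroup F] [NormedSpace ℝ F]

omit [NormedSpace ℝ F] in
/-- Slices of a path with continuous space–time lift on `[0,1] × ℝ³` are continuous. -/
theorem continuous_slice_of_continuousOn_stLift {f : ℝ → UnitAddTorus (Fin 3) → F}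
    (h : ContinuousOn (Torus.stLift f) (Icc (0 : ℝ) 1 ×ˢ univ)) {s : ℝ} (hs : s ∈ Icc (0 : ℝ) 1) :
    Continuous (f s) := by
  have h1 : Continuous fun y : EuclideanSpace ℝ (Fin 3) => Torus.stLift f (s, y) :=
    h.comp_continuous (continuous_const.prodMk continuous_id) fun y => mk_mem_prod hs (mem_univ y)
  rw [Torus.isOpenQuotientMap_proj.isQuotientMap.continuous_iff]
  exact h1

omit [NormedSpace ℝ F] in
/-- Along a path with continuous space–time lift on `[0,1] × ℝ³`, `s ↦ f s x` is continuous on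
`[0,1]` for every `x`. -/
theorem continuousOn_param_of_continuousOn_stLift {f : ℝ → UnitAddTorus (Fin 3) → F}
    (h : ContinuousOn (Torus.stLift f) (Icc (0 : ℝ) 1 ×ˢ univ)) (x : UnitAddTorus (Fin 3)) :
    ContinuousOn (fun s => f s x) (Icc (0 : ℝ) 1) := by
  have h1 : ContinuousOn (fun s : ℝ => Torus.stLift f (s, Torus.repr x)) (Icc (0 : ℝ) 1) :=
    h.comp (continuous_id.prodMk continuous_const).continuousOn fun s hs => mk_mem_prod hs (mem_univ _)
  refine h1.congr fun s _ => ?_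
  simp [Torus.stLift_apply, Torus.proj_repr]

/-- At interior times, `s ↦ f s (proj y)` has derivative `D(stLift f)(s, y)·(1, 0)`. -/
theorem hasDerivAt_param_of_contDiffOn {f : ℝ → UnitAddTorus (Fin 3) → F}
    (h : ContDiffOn ℝ 1 (Torus.stLift f) (Icc (0 : ℝ) 1 ×ˢ univ)) {s : ℝ} (hs : s ∈ Ioo (0 : ℝ) 1)
    (y : EuclideanSpace ℝ (Fin 3)) :
    HasDerivAt (fun r => f r (Torus.proj y)) (fderiv ℝ (Torus.stLift f) (s, y) ((1 : ℝ), (0 : EuclideanSpace ℝ (Fin 3)))) s := by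
  have hnhds : Icc (0 : ℝ) 1 ×ˢ (univ : Set (EuclideanSpace ℝ (Fin 3))) ∈ 𝓝 (s, y) :=
    prod_mem_nhds (Icc_mem_nhds hs.1 hs.2) univ_mem
  have hdiff : DifferentiableAt ℝ (Torus.stLift f) (s, y) :=
    (h.differentiableOn one_ne_zero).differentiableAt hnhds
  have hcurve : HasDerivAt (fun r : ℝ => (r, y)) ((1 : ℝ), (0 : EuclideanSpace ℝ (Fin 3))) s :=
    (hasDerivAt_id s).prodMk (hasDerivAt_const s y)
  have hcomp := hdiff.hasFDerivAt.comp_hasDerivAt s hcurve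
  exact hcomp

/-- At interior times the derivative of `s ↦ f s x` is `D(stLift f)(s, y)·(1, 0)` for every lift
`y` of `x` (uniqueness of derivatives); in particular it does not depend on the lift. -/
theorem deriv_param_eq_fderiv {f : ℝ → UnitAddTorus (Fin 3) → F}
    (h : ContDiffOn ℝ 1 (Torus.stLift f) (Icc (0 : ℝ) 1 ×ˢ univ)) {s : ℝ} (hs : s ∈ Ioo (0 : ℝ) 1)
    (y : EuclideanSpace ℝ (Fin 3)) :
    deriv (fun r => f r (Torus.proj y)) s =
      fderiv ℝ (Torus.stLift f) (s, y) ((1 : ℝ), (0 : EuclideanSpace ℝ (Fin 3))) :=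
  (hasDerivAt_param_of_contDiffOn h hs y).deriv

/-- **Differentiability in the path parameter** at interior times, with the derivative written as
`deriv`. -/
theorem hasDerivAt_param_of_contDiffOn' {f : ℝ → UnitAddTorus (Fin 3) → F}
    (h : ContDiffOn ℝ 1 (Torus.stLift f) (Icc (0 : ℝ) 1 ×ˢ univ)) {s : ℝ} (hs : s ∈ Ioo (0 : ℝ) 1)
    (x : UnitAddTorus (Fin 3)) :
    HasDerivAt (fun r => f r x) (deriv (fun r => f r x) s) s := by
  obtain ⟨y, rfl⟩ := Torus.proj_surjective x
  exact (hasDerivAt_param_of_contDiffOn h hs y).differentiableAt.hasDerivAt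

/-- **Continuity in `x` of the path-derivative** at interior times. -/
theorem continuous_deriv_param_of_contDiffOn {f : ℝ → UnitAddTorus (Fin 3) → F}
    (h : ContDiffOn ℝ 1 (Torus.stLift f) (Icc (0 : ℝ) 1 ×ˢ univ)) {s : ℝ} (hs : s ∈ Ioo (0 : ℝ) 1) :
    Continuous fun x => deriv (fun r => f r x) s := by
  -- on the open set `(0,1) × ℝ³` the lift is `C¹`, so its derivative is continuous
  have hopen : IsOpen (Ioo (0 : ℝ) 1 ×ˢ (univ : Set (EuclideanSpace ℝ (Fin 3)))) :=
    isOpen_Ioo.prod isOpen_univ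
  have hsub : Ioo (0 : ℝ) 1 ×ˢ (univ : Set (EuclideanSpace ℝ (Fin 3))) ⊆ Icc 0 1 ×ˢ univ :=
    prod_mono Ioo_subset_Icc_self le_rfl
  have hcont : ContinuousOn (fderiv ℝ (Torus.stLift f)) (Ioo (0 : ℝ) 1 ×ˢ univ) :=
    (h.mono hsub).continuousOn_fderiv_of_isOpen hopen le_rfl
  have h1 : Continuous fun y : EuclideanSpace ℝ (Fin 3) =>
      fderiv ℝ (Torus.stLift f) (s, y) ((1 : ℝ), (0 : EuclideanSpace ℝ (Fin 3))) := by
    have h2 : Continuous fun y : EuclideanSpace ℝ (Fin 3) => fderiv ℝ (Torus.stLift f) (s, y) :=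
      hcont.comp_continuous (continuous_const.prodMk continuous_id)
        fun y => mk_mem_prod hs (mem_univ y)
    exact h2.clm_apply continuous_const
  rw [Torus.isOpenQuotientMap_proj.isQuotientMap.continuous_iff]
  refine h1.congr fun y => ?_
  simp only [Function.comp_apply]
  exact (deriv_param_eq_fderiv h hs y).symm

/-- The closed unit cube of `ℝ³` is compact and contains all representatives. -/
theorem isCompact_closedCube :
    IsCompact {y : EuclideanSpace ℝ (Fin 3) | ∀ i, y i ∈ Icc (0 : ℝ) 1} := by
  refine Metric.isCompact_of_isClosed_isBounded ?_ ?_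
  · have : {y : EuclideanSpace ℝ (Fin 3) | ∀ i, y i ∈ Icc (0 : ℝ) 1} =
        ⋂ i, (fun y : EuclideanSpace ℝ (Fin 3) => y i) ⁻¹' Icc 0 1 := by
      ext y; simp
    rw [this]
    refine isClosed_iInter fun i => isClosed_Icc.preimage ?_
    exact (EuclideanSpace.proj (𝕜 := ℝ) i).continuous
  · refine (Metric.isBounded_iff_subset_closedBall (0 : EuclideanSpace ℝ (Fin 3))).2 ⟨3, fun y hy => ?_⟩
    rw [mem_closedBall, dist_zero_right, EuclideanSpace.norm_eq]
    have hsum : ∑ i, ‖y i‖ ^ 2 ≤ ∑ _i : Fin 3, (1 : ℝ) := Finset.sum_le_sum fun i _ => by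
      have hi := hy i
      rw [Real.norm_eq_abs, sq_abs]
      nlinarith [hi.1, hi.2]
    simp only [Finset.sum_const, Finset.card_univ, Fintype.card_fin, nsmul_eq_mul, mul_one] at hsum
    calc Real.sqrt (∑ i, ‖y i‖ ^ 2) ≤ Real.sqrt 3 := Real.sqrt_le_sqrt (by exact_mod_cast hsum)
      _ ≤ 3 := by
        rw [Real.sqrt_le_left (by norm_num)]
        norm_num

/-- Representatives lie in the closed unit cube. -/
theorem repr_mem_closedCube (x : UnitAddTorus (Fin 3)) :
    Torus.repr x ∈ {y : EuclideanSpace ℝ (Fin 3) | ∀ i, y i ∈ Icc (0 : ℝ) 1} :=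
  fun i => Ico_subset_Icc_self (Torus.repr_apply_mem_Ico x i)

/-- **Uniform bound on the path-derivative** over `(0,1) × 𝕋³`: the within-derivative of the
`C¹` lift is continuous on `[0,1] × ℝ³`, hence bounded on `[0,1] ×` the closed unit cube, and it
is the derivative at interior points. -/
theorem exists_bound_deriv_param_of_contDiffOn {f : ℝ → UnitAddTorus (Fin 3) → F}
    (h : ContDiffOn ℝ 1 (Torus.stLift f) (Icc (0 : ℝ) 1 ×ˢ univ)) :
    ∃ K₁ : ℝ, 0 ≤ K₁ ∧ ∀ s ∈ Ioo (0 : ℝ) 1, ∀ x : UnitAddTorus (Fin 3),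
      ‖deriv (fun r => f r x) s‖ ≤ K₁ := by
  have hU : UniqueDiffOn ℝ (Icc (0 : ℝ) 1 ×ˢ (univ : Set (EuclideanSpace ℝ (Fin 3)))) :=
    (uniqueDiffOn_Icc zero_lt_one).prod uniqueDiffOn_univ
  have hc : ContinuousOn (fderivWithin ℝ (Torus.stLift f) (Icc (0 : ℝ) 1 ×ˢ univ))
      (Icc (0 : ℝ) 1 ×ˢ univ) := h.continuousOn_fderivWithin hU le_rfl
  set Kc : Set (ℝ × EuclideanSpace ℝ (Fin 3)) :=
    Icc (0 : ℝ) 1 ×ˢ {y : EuclideanSpace ℝ (Fin 3) | ∀ i, y i ∈ Icc (0 : ℝ) 1} with hKc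
  have hKcpt : IsCompact Kc := isCompact_Icc.prod isCompact_closedCube
  have hKsub : Kc ⊆ Icc (0 : ℝ) 1 ×ˢ univ := prod_mono le_rfl (subset_univ _)
  obtain ⟨K, hK⟩ := hKcpt.exists_bound_of_continuousOn (hc.mono hKsub)
  refine ⟨max K 0, le_max_right _ _, fun s hs x => ?_⟩
  have hmem : (s, Torus.repr x) ∈ Kc := mk_mem_prod (Ioo_subset_Icc_self hs) (repr_mem_closedCube x)
  have hnhds : Icc (0 : ℝ) 1 ×ˢ (univ : Set (EuclideanSpace ℝ (Fin 3))) ∈ 𝓝 (s, Torus.repr x) :=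
    prod_mem_nhds (Icc_mem_nhds hs.1 hs.2) univ_mem
  have hfd : fderiv ℝ (Torus.stLift f) (s, Torus.repr x) =
      fderivWithin ℝ (Torus.stLift f) (Icc (0 : ℝ) 1 ×ˢ univ) (s, Torus.repr x) :=
    (fderivWithin_of_mem_nhds hnhds).symm
  have hx : deriv (fun r => f r x) s =
      fderiv ℝ (Torus.stLift f) (s, Torus.repr x) ((1 : ℝ), (0 : EuclideanSpace ℝ (Fin 3))) := by
    have := deriv_param_eq_fderiv h hs (Torus.repr x)
    rwa [Torus.proj_repr] at this
  rw [hx, hfd]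
  calc ‖fderivWithin ℝ (Torus.stLift f) (Icc (0 : ℝ) 1 ×ˢ univ) (s, Torus.repr x) ((1 : ℝ), 0)‖
      ≤ ‖fderivWithin ℝ (Torus.stLift f) (Icc (0 : ℝ) 1 ×ˢ univ) (s, Torus.repr x)‖ * ‖((1 : ℝ), (0 : EuclideanSpace ℝ (Fin 3)))‖ :=
        ContinuousLinearMap.le_opNorm _ _
    _ ≤ K * 1 := by
        refine mul_le_mul (hK _ hmem) ?_ (norm_nonneg _) ((norm_nonneg _).trans (hK _ hmem))
        simp [Prod.norm_def]
    _ ≤ max K 0 := by rw [mul_one]; exact le_max_left _ _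

/-- **The pointwise regularity package of a `C¹` path of profiles** (everything the
`δ`-derivative of local Gibbs means uses): continuity of slices and of `s ↦ f s x` on `[0,1]`,
differentiability in `s` on `(0,1)` with `x`-continuous, uniformly bounded derivative. -/
theorem path_regular_of_contDiffOn {f : ℝ → UnitAddTorus (Fin 3) → F}
    (h : ContDiffOn ℝ 1 (Torus.stLift f) (Icc (0 : ℝ) 1 ×ˢ univ)) :
    (∀ s ∈ Icc (0 : ℝ) 1, Continuous (f s)) ∧
    (∀ x, ContinuousOn (fun s => f s x) (Icc (0 : ℝ) 1)) ∧
    (∀ s ∈ Ioo (0 : ℝ) 1, ∀ x, HasDerivAt (fun r => f r x) (deriv (fun r => f r x) s) s) ∧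
    (∀ s ∈ Ioo (0 : ℝ) 1, Continuous fun x => deriv (fun r => f r x) s) ∧
    ∃ K₁ : ℝ, 0 ≤ K₁ ∧ ∀ s ∈ Ioo (0 : ℝ) 1, ∀ x, ‖deriv (fun r => f r x) s‖ ≤ K₁ :=
  ⟨fun _ hs => continuous_slice_of_continuousOn_stLift h.continuousOn hs,
    continuousOn_param_of_continuousOn_stLift h.continuousOn,
    fun _ hs x => hasDerivAt_param_of_contDiffOn' h hs x,
    fun _ hs => continuous_deriv_param_of_contDiffOn h hs,
    exists_bound_deriv_param_of_contDiffOn h⟩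

end Summit.AtomisticToContinuum.HydrodynamicLimit.Theorems.AmplitudeTransfer

end
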